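import Summits.AtomisticToContinuum.Crystallization.Theorems.HullExactificationCascadeZeroDefectDensityCensusCoreAux
import HarnessLib

/-!
# The Voronoi ownership census — core assembly, part 2/2: the registered stub `stub_censusCore`
# (route `HullExactificationCascade`, crux `ZeroDefectDensity`, stmt-AtomisticToContinuum-12086; line `birth`, lead c5)

From the tangent-plane windows (`stub_censusFrame`) and the two transported model areas
(`stub_censusContain`), the census: on the sphere of directions about `u`, the twelve regions
`C i = capCone (dir i) (893/1250) ∩ ⋂_{contacts j} {⟪dir j, x⟫ ≤ ⟪dir i, x⟫}` are pairwise a.e.-disjoint, so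
their ball fractions sum to `≤ 1`; second-order inclusion–exclusion (exact, all triple overlaps being
empty) bounds each from below by `357/2500 − k·16423/10⁶ + m·753/250000` (`k ≤ 4` contacts, `m` contact pairs
among them, `(k, m) = (4, ≤ 1)` excluded by the pigeonhole); since `12·(357/2500 − 4σ₁ + 2σ₂) + σ₂ > 1`, every
vertex has exactly four contacts and exactly two contact pairs among them.  Tools: part 1/2.
-/

noncomputable section

namespace Summit.AtomisticToContinuum.Crystallization.Theorems.ZeroDefectDensityBirth

open MeasureTheory Metric Set Real RealInnerProductSpace Literature.Geometry.DiscreteGeometry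


/-- **STUB K2d — the census core (registered signature, verbatim).**  From the tangent-plane windows and the two
transported model bounds: every shell point has exactly four soft contacts, exactly two pairs of which are in
contact. [folklore] -/
theorem stub_censusCore : (∀ (u : EuclideanSpace ℝ (Fin 3)) (p : Fin 12 → EuclideanSpace ℝ (Fin 3)), (∀ i : Fin 12, 1 - 1 / 4000 ≤ dist u (p i) ∧ dist u (p i) ≤ 1 + 1 / 4000) → (∀ i j : Fin 12, i ≠ j → 1 - 1 / 4000 ≤ dist (p i) (p j) ∧ (dist (p i) (p j) ≤ 1 + 1 / 4000 ∨ 7 / 5 ≤ dist (p i) (p j))) → (∀ i : Fin 12, {j : Fin 12 | j ≠ i ∧ dist (p i) (p j) ≤ 1 + 1 / 4000}.ncard ≤ 4) → (∀ i : Fin 12, {j : Fin 12 | j ≠ i ∧ dist (p i) (p j) ≤ 1 + 1 / 4000}.ncard = 4 → 2 ≤ {q : Fin 12 × Fin 12 | q.1 < q.2 ∧ q.1 ≠ i ∧ q.2 ≠ i ∧ dist (p i) (p q.1) ≤ 1 + 1 / 4000 ∧ dist (p i) (p q.2) ≤ 1 + 1 / 4000 ∧ dist (p q.1) (p q.2)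 ≤ 1 + 1 / 4000}.ncard) ∧ (∀ i j k l : Fin 12, j ≠ i → k ≠ i → l ≠ i → j ≠ k → j ≠ l → k ≠ l → dist (p i) (p j) ≤ 1 + 1 / 4000 → dist (p i) (p k) ≤ 1 + 1 / 4000 → dist (p i) (p l) ≤ 1 + 1 / 4000 → (Literature.Geometry.DiscreteGeometry.capCone (‖p i - u‖⁻¹ • (p i - u)) (893 / 1250) ∩ {x : EuclideanSpace ℝ (Fin 3) | inner ℝ (‖p i - u‖⁻¹ • (p i - u)) x < inner ℝ (‖p j - u‖⁻¹ • (p j - u)) x} ∩ {x : EuclideanSpace ℝ (Fin 3) | inner ℝ (‖p i - u‖⁻¹ • (p i - u)) x < inner ℝ (‖p k - u‖⁻¹ • (p k - u)) x} = ∅ ∨ Literature.Geometry.DiscreteGeometry.capCone (‖p i - u‖⁻¹ • (p i - u)) (893 / 1250) ∩ {x : EuclideanSpace ℝ (Fin 3) | inner ℝ (‖p i - u‖⁻¹ • (p i - u)) x < inner ℝ (‖p j - u‖⁻¹ • (p j - u)) x} ∩ {x : EuclideanSpace ℝ (Fin 3) | inner ℝ (‖p i - u‖⁻¹ • (p i -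 u)) x < inner ℝ (‖p l - u‖⁻¹ • (p l - u)) x} = ∅ ∨ Literature.Geometry.DiscreteGeometry.capCone (‖p i - u‖⁻¹ • (p i - u)) (893 / 1250) ∩ {x : EuclideanSpace ℝ (Fin 3) | inner ℝ (‖p i - u‖⁻¹ • (p i - u)) x < inner ℝ (‖p k - u‖⁻¹ • (p k - u)) x} ∩ {x : EuclideanSpace ℝ (Fin 3) | inner ℝ (‖p i - u‖⁻¹ • (p i - u)) x < inner ℝ (‖p l - u‖⁻¹ • (p l - u)) x} = ∅)) ∧ (∀ i j : Fin 12, i ≠ j → ¬ dist (p i) (p j) ≤ 1 + 1 / 4000 → Literature.Geometry.DiscreteGeometry.capCone (‖p i - u‖⁻¹ • (p i - u)) (893 / 1250) ∩ Literature.Geometry.DiscreteGeometry.capCone (‖p j - u‖⁻¹ • (p j - u)) (893 / 1250) = ∅)) → (∀ (u : EuclideanSpace ℝ (Fin 3)) (p : Fin 12 → EuclideanSpace ℝ (Fin 3)), (∀ i : Fin 12, 1 - 1 / 4000 ≤ dist u (p i) ∧ dist u (p i) ≤ 1 + 1 / 4000) → (∀ i j : Fin 12, i ≠ j → 1 - 1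 / 4000 ≤ dist (p i) (p j) ∧ (dist (p i) (p j) ≤ 1 + 1 / 4000 ∨ 7 / 5 ≤ dist (p i) (p j))) → (∀ i j : Fin 12, i ≠ j → dist (p i) (p j) ≤ 1 + 1 / 4000 → Literature.Geometry.DiscreteGeometry.ballFraction (0 : EuclideanSpace ℝ (Fin 3)) (Literature.Geometry.DiscreteGeometry.capCone (‖p i - u‖⁻¹ • (p i - u)) (893 / 1250) ∩ {x : EuclideanSpace ℝ (Fin 3) | inner ℝ (‖p i - u‖⁻¹ • (p i - u)) x < inner ℝ (‖p j - u‖⁻¹ • (p j - u)) x}) ≤ 16423 / 1000000) ∧ (∀ i j k : Fin 12, i ≠ j → i ≠ k → j ≠ k → dist (p i) (p j) ≤ 1 + 1 / 4000 → dist (p i) (p k) ≤ 1 + 1 / 4000 → dist (p j) (p k) ≤ 1 + 1 / 4000 → (753 / 250000 : ℝ) ≤ Literature.Geometry.DiscreteGeometry.ballFraction (0 : EuclideanSpace ℝ (Fin 3)) (Literature.Geometry.DiscreteGeometry.capCone (‖p i - u‖⁻¹ • (p i - u)) (893 / 1250) ∩ {x : EuclideanSpace ℝ (Fin 3) | inner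 ℝ (‖p i - u‖⁻¹ • (p i - u)) x < inner ℝ (‖p j - u‖⁻¹ • (p j - u)) x} ∩ {x : EuclideanSpace ℝ (Fin 3) | inner ℝ (‖p i - u‖⁻¹ • (p i - u)) x < inner ℝ (‖p k - u‖⁻¹ • (p k - u)) x}))) → ∀ (u : EuclideanSpace ℝ (Fin 3)) (p : Fin 12 → EuclideanSpace ℝ (Fin 3)), (∀ i : Fin 12, 1 - 1 / 4000 ≤ dist u (p i) ∧ dist u (p i) ≤ 1 + 1 / 4000) → (∀ i j : Fin 12, i ≠ j → 1 - 1 / 4000 ≤ dist (p i) (p j) ∧ (dist (p i) (p j) ≤ 1 + 1 / 4000 ∨ 7 / 5 ≤ dist (p i) (p j))) → (∀ i : Fin 12, {j : Fin 12 | j ≠ i ∧ dist (p i) (p j) ≤ 1 + 1 / 4000}.ncard ≤ 4) → ∀ i : Fin 12, {j : Fin 12 | j ≠ i ∧ dist (p i) (p j) ≤ 1 + 1 / 4000}.ncard = 4 ∧ {q : Fin 12 × Fin 12 | q.1 < q.2 ∧ q.1 ≠ i ∧ q.2 ≠ i ∧ dist (p i) (p q.1) ≤ 1 + 1 / 4000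 ∧ dist (p i) (p q.2) ≤ 1 + 1 / 4000 ∧ dist (p q.1) (p q.2) ≤ 1 + 1 / 4000}.ncard = 2 := by
  intro hFrame hContain u p hR hP h4
  classical
  obtain ⟨hpig, htri, hfar⟩ := hFrame u p hR hP h4
  obtain ⟨hseg, hov⟩ := hContain u p hR hP
  -- abbreviations
  set dir : Fin 12 → (EuclideanSpace ℝ (Fin 3)) := fun i => ‖p i - u‖⁻¹ • (p i - u) with hdir_def
  set ct : Fin 12 → Fin 12 → Prop := fun i j => j ≠ i ∧ dist (p i) (p j) ≤ 1 + 1 / 4000 with hct_def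
  set J : Fin 12 → Finset (Fin 12) := fun i => Finset.univ.filter fun j => ct i j with hJ_def
  have hJ : ∀ i j, j ∈ J i ↔ (j ≠ i ∧ dist (p i) (p j) ≤ 1 + 1 / 4000) := fun i j => by
    simp [hJ_def, hct_def]
  set M : Fin 12 → Fin 12 → Prop := fun j l => dist (p j) (p l) ≤ 1 + 1 / 4000 with hM_def
  set PP : Fin 12 → Finset (Fin 12 × Fin 12) := fun i => (J i ×ˢ J i).filter (fun q => q.1 < q.2 ∧ M q.1 q.2)
    with hPP_def
  set K : Fin 12 → Set (EuclideanSpace ℝ (Fin 3)) := fun i => capCone (dir i) (893 / 1250) with hK_def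
  set A : Fin 12 → Fin 12 → Set (EuclideanSpace ℝ (Fin 3)) := fun i j => K i ∩ {x : (EuclideanSpace ℝ (Fin 3)) | ⟪dir i, x⟫ < ⟪dir j, x⟫} with hA_def
  set C : Fin 12 → Set (EuclideanSpace ℝ (Fin 3)) := fun i => K i ∩ ⋂ j ∈ J i, {x : (EuclideanSpace ℝ (Fin 3)) | ⟪dir j, x⟫ ≤ ⟪dir i, x⟫} with hC_def
  have hunit : ∀ i, ‖dir i‖ = 1 := fun i => ccore_dir_unit hR i
  have hAA : ∀ i j k, A i j ∩ A i k =
      capCone (dir i) (893 / 1250) ∩ {x : (EuclideanSpace ℝ (Fin 3)) | ⟪dir i, x⟫ < ⟪dir j, x⟫} ∩ {x : (EuclideanSpace ℝ (Fin 3)) | ⟪dir i, x⟫ < ⟪dir k, x⟫} := by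
    intro i j k
    ext x
    simp only [hA_def, hK_def, Set.mem_inter_iff, Set.mem_setOf_eq]
    tauto
  have hseg' : ∀ i j, i ≠ j → dist (p i) (p j) ≤ 1 + 1 / 4000 →
      ballFraction (0 : (EuclideanSpace ℝ (Fin 3))) (A i j) ≤ 16423 / 1000000 := fun i j hij hd => hseg i j hij hd
  have hov' : ∀ i j k, i ≠ j → i ≠ k → j ≠ k → dist (p i) (p j) ≤ 1 + 1 / 4000 →
      dist (p i) (p k) ≤ 1 + 1 / 4000 → dist (p j) (p k) ≤ 1 + 1 / 4000 →
      (753 / 250000 : ℝ) ≤ ballFraction (0 : (EuclideanSpace ℝ (Fin 3))) (A i j ∩ A i k) := by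
    intro i j k hij hik hjk h1 h2 h3
    rw [hAA]
    exact hov i j k hij hik hjk h1 h2 h3
  -- the finsets versus the `ncard`s of the statement
  have hJset : ∀ i, ({j : Fin 12 | j ≠ i ∧ dist (p i) (p j) ≤ 1 + 1 / 4000} : Set (Fin 12)) = ↑(J i) := by
    intro i; ext j; simp [hJ_def, hct_def]
  have hPPset : ∀ i, ({q : Fin 12 × Fin 12 | q.1 < q.2 ∧ q.1 ≠ i ∧ q.2 ≠ i ∧ dist (p i) (p q.1) ≤ 1 + 1 / 4000 ∧ dist (p i) (p q.2) ≤ 1 + 1 / 4000 ∧ dist (p q.1) (p q.2) ≤ 1 + 1 / 4000} : Set (Fin 12 × Fin 12)) = ↑(PP i) := by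
    intro i; ext q
    rw [Finset.mem_coe]
    simp only [hPP_def, Finset.mem_filter, Finset.mem_product, hJ, Set.mem_setOf_eq, hM_def]
    tauto
  have hk4 : ∀ i, (J i).card ≤ 4 := by
    intro i
    have := h4 i
    rwa [hJset, Set.ncard_coe_finset] at this
  have hpig' : ∀ i, (J i).card = 4 → 2 ≤ (PP i).card := by
    intro i h
    have h1 := hpig i (by rw [hJset, Set.ncard_coe_finset]; exact h)
    rwa [hPPset, Set.ncard_coe_finset] at h1
  -- measurability
  have hKm : ∀ i, MeasurableSet (K i) := fun i => measurableSet_capCone _ _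
  have hHle : ∀ i j, MeasurableSet {x : (EuclideanSpace ℝ (Fin 3)) | ⟪dir j, x⟫ ≤ ⟪dir i, x⟫} := fun i j =>
    (isClosed_le (continuous_const.inner continuous_id) (continuous_const.inner continuous_id)).measurableSet
  have hHlt : ∀ i j, MeasurableSet {x : (EuclideanSpace ℝ (Fin 3)) | ⟪dir i, x⟫ < ⟪dir j, x⟫} := fun i j =>
    (isOpen_lt (continuous_const.inner continuous_id) (continuous_const.inner continuous_id)).measurableSet
  have hAm : ∀ i j, MeasurableSet (A i j) := fun i j => (hKm i).inter (hHlt i j)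
  have hCm : ∀ i, MeasurableSet (C i) := fun i =>
    (hKm i).inter (Finset.measurableSet_biInter _ fun j _ => hHle i j)
  have hKball : ∀ i, K i ⊆ ball 0 1 := fun i => ccore_capCone_subset_ball _ _
  have hCK : ∀ i, C i ⊆ K i := fun i => Set.inter_subset_left
  have hAK : ∀ i j, A i j ⊆ K i := fun i j => Set.inter_subset_left
  have hAball : ∀ i j, A i j ⊆ ball 0 1 := fun i j => (hAK i j).trans (hKball i)
  have hfin : ∀ {S : Set (EuclideanSpace ℝ (Fin 3))}, S ⊆ ball 0 1 → volume S ≠ ⊤ := fun hS =>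
    (measure_lt_top_of_subset hS measure_ball_lt_top.ne).ne
  -- Step 1: the cells are pairwise a.e.-disjoint, so their fractions sum to `≤ 1`
  have hnull : (↑(Finset.univ : Finset (Fin 12)) : Set (Fin 12)).Pairwise fun i j => volume (C i ∩ C j) = 0 := by
    intro i _ j _ hij
    by_cases hc : dist (p i) (p j) ≤ 1 + 1 / 4000
    · have hjJ : j ∈ J i := (hJ i j).2 ⟨hij.symm, hc⟩
      have hiJ : i ∈ J j := (hJ j i).2 ⟨hij, by rw [dist_comm]; exact hc⟩
      have hsub : C i ∩ C j ⊆ {x : (EuclideanSpace ℝ (Fin 3)) | ⟪dir i - dir j, x⟫ = 0} := by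
        rintro x ⟨hxi, hxj⟩
        have h1 : ⟪dir j, x⟫ ≤ ⟪dir i, x⟫ := by
          have := hxi.2; rw [Set.mem_iInter₂] at this; exact this j hjJ
        have h2 : ⟪dir i, x⟫ ≤ ⟪dir j, x⟫ := by
          have := hxj.2; rw [Set.mem_iInter₂] at this; exact this i hiJ
        show ⟪dir i - dir j, x⟫ = 0
        rw [inner_sub_left]; linarith
      exact measure_mono_null hsub (ccore_plane_null (sub_ne_zero.2 (ccore_dir_ne hR hP hij)))
    · have hKK : K i ∩ K j = ∅ := hfar i j hij hc
      have : C i ∩ C j = ∅ := Set.subset_eq_empty (Set.inter_subset_inter (hCK i) (hCK j)) hKK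
      rw [this, measure_empty]
  have hsum : ∑ i, ballFraction (0 : (EuclideanSpace ℝ (Fin 3))) (C i) ≤ 1 :=
    sum_ballFraction_le_one Finset.univ 0 (fun i _ => hCm i) hnull
  -- Step 2: per-vertex lower bound, in volumes
  have hKsplit : ∀ i, K i = C i ∪ ⋃ j ∈ J i, A i j := by
    intro i
    ext x
    simp only [hC_def, hA_def, Set.mem_union, Set.mem_inter_iff, Set.mem_iInter, Set.mem_iUnion,
      Set.mem_setOf_eq, exists_prop]
    constructor
    · intro hx
      by_cases hall : ∀ j ∈ J i, ⟪dir j, x⟫ ≤ ⟪dir i, x⟫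
      · exact Or.inl ⟨hx, hall⟩
      · push Not at hall
        obtain ⟨j, hj, hlt⟩ := hall
        exact Or.inr ⟨j, hj, hx, hlt⟩
    · rintro (⟨hx, -⟩ | ⟨j, -, hx, -⟩) <;> exact hx
  have hKdisj : ∀ i, Disjoint (C i) (⋃ j ∈ J i, A i j) := by
    intro i
    rw [Set.disjoint_left]
    rintro x ⟨-, hxC⟩ hxU
    rw [Set.mem_iInter₂] at hxC
    simp only [Set.mem_iUnion, exists_prop] at hxU
    obtain ⟨j, hj, -, hlt⟩ := hxU
    exact (not_lt.2 (show ⟪dir j, x⟫ ≤ ⟪dir i, x⟫ from hxC j hj)) hlt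
  have hUm : ∀ i, MeasurableSet (⋃ j ∈ J i, A i j) := fun i =>
    Finset.measurableSet_biUnion _ fun j _ => hAm i j
  have hvolK : ∀ i, volume (K i) = volume (C i) + volume (⋃ j ∈ J i, A i j) := by
    intro i
    conv_lhs => rw [hKsplit i]
    exact measure_union (hKdisj i) (hUm i)
  have h3 : ∀ i, ∀ j ∈ J i, ∀ k ∈ J i, ∀ l ∈ J i, j ≠ k → j ≠ l → k ≠ l →
      volume (A i j ∩ A i k ∩ A i l) = 0 := by
    intro i j hj k hk l hl hjk hjl hkl
    rw [hJ] at hj hk hl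
    have hsub₁ : A i j ∩ A i k ∩ A i l ⊆ K i ∩ {x : (EuclideanSpace ℝ (Fin 3)) | ⟪dir i, x⟫ < ⟪dir j, x⟫} ∩ {x : (EuclideanSpace ℝ (Fin 3)) | ⟪dir i, x⟫ < ⟪dir k, x⟫} := by
      rintro x ⟨⟨⟨hxK, hxj⟩, ⟨-, hxk⟩⟩, -⟩; exact ⟨⟨hxK, hxj⟩, hxk⟩
    have hsub₂ : A i j ∩ A i k ∩ A i l ⊆ K i ∩ {x : (EuclideanSpace ℝ (Fin 3)) | ⟪dir i, x⟫ < ⟪dir j, x⟫} ∩ {x : (EuclideanSpace ℝ (Fin 3)) | ⟪dir i, x⟫ < ⟪dir l, x⟫} := by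
      rintro x ⟨⟨⟨hxK, hxj⟩, -⟩, ⟨-, hxl⟩⟩; exact ⟨⟨hxK, hxj⟩, hxl⟩
    have hsub₃ : A i j ∩ A i k ∩ A i l ⊆ K i ∩ {x : (EuclideanSpace ℝ (Fin 3)) | ⟪dir i, x⟫ < ⟪dir k, x⟫} ∩ {x : (EuclideanSpace ℝ (Fin 3)) | ⟪dir i, x⟫ < ⟪dir l, x⟫} := by
      rintro x ⟨⟨-, ⟨hxK, hxk⟩⟩, ⟨-, hxl⟩⟩; exact ⟨⟨hxK, hxk⟩, hxl⟩
    rcases htri i j k l hj.1 hk.1 hl.1 hjk hjl hkl hj.2 hk.2 hl.2 with h | h | h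
    · exact measure_mono_null hsub₁ (by rw [h]; exact measure_empty)
    · exact measure_mono_null hsub₂ (by rw [h]; exact measure_empty)
    · exact measure_mono_null hsub₃ (by rw [h]; exact measure_empty)
  have hbon : ∀ i, volume (⋃ j ∈ J i, A i j) +
      ∑ q ∈ PP i, volume (A i q.1 ∩ A i q.2) ≤ ∑ j ∈ J i, volume (A i j) := by
    intro i
    have := ccore_bonferroni2 volume (A i) (hAm i) (J i) (h3 i) M
    rwa [ccore_sum_pairs (J i) (fun j l => j < l ∧ M j l) (fun j l => volume (A i j ∩ A i l))] at this
  -- Step 3: real-valued per-vertex bound with the two model constants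
  set V : ℝ := (volume (ball (0 : (EuclideanSpace ℝ (Fin 3))) 1)).toReal with hV_def
  have hVpos : 0 < V := ENNReal.toReal_pos (measure_ball_pos volume 0 one_pos).ne' measure_ball_lt_top.ne
  have hlow : ∀ i, (357 / 2500 : ℝ) - (J i).card * (16423 / 1000000) + (PP i).card * (753 / 250000) ≤
      ballFraction (0 : (EuclideanSpace ℝ (Fin 3))) (C i) := by
    intro i
    -- volumes as reals
    have hfinU : volume (⋃ j ∈ J i, A i j) ≠ ⊤ := hfin (Set.iUnion₂_subset fun j _ => hAball i j)
    have hfinA : ∀ j, volume (A i j) ≠ ⊤ := fun j => hfin (hAball i j)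
    have hfinAA : ∀ q : Fin 12 × Fin 12, volume (A i q.1 ∩ A i q.2) ≠ ⊤ := fun q =>
      hfin (Set.inter_subset_left.trans (hAball i q.1))
    have hfinC : volume (C i) ≠ ⊤ := hfin ((hCK i).trans (hKball i))
    have hb := (ENNReal.toReal_le_toReal
      (ENNReal.add_ne_top.2 ⟨hfinU, ENNReal.sum_ne_top.2 fun q _ => hfinAA q⟩)
      (ENNReal.sum_ne_top.2 fun j _ => hfinA j)).2 (hbon i)
    rw [ENNReal.toReal_add hfinU (ENNReal.sum_ne_top.2 fun q _ => hfinAA q),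
      ENNReal.toReal_sum (fun j _ => hfinA j), ENNReal.toReal_sum (fun q _ => hfinAA q)] at hb
    -- `vol K = vol C + vol U` and `vol K / V = 357/2500`
    have hKfrac : (volume (K i)).toReal / V = 357 / 2500 := by
      rw [← ccore_bf_eq (hKball i)]; exact ccore_bf_capCone (hunit i)
    have hvK := congrArg ENNReal.toReal (hvolK i)
    rw [ENNReal.toReal_add hfinC hfinU] at hvK
    -- the two model bounds, summed
    have h1 : ∑ j ∈ J i, (volume (A i j)).toReal / V ≤ (J i).card * (16423 / 1000000) := by
      have : ∀ j ∈ J i, (volume (A i j)).toReal / V ≤ 16423 / 1000000 := by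
        intro j hj
        rw [hJ] at hj
        have := hseg' i j (Ne.symm hj.1) hj.2
        rwa [ccore_bf_eq (hAball i j)] at this
      calc ∑ j ∈ J i, (volume (A i j)).toReal / V ≤ ∑ j ∈ J i, (16423 / 1000000 : ℝ) :=
            Finset.sum_le_sum this
        _ = (J i).card * (16423 / 1000000) := by rw [Finset.sum_const, nsmul_eq_mul]
    have h2 : ((PP i).card : ℝ) * (753 / 250000) ≤ ∑ q ∈ PP i, (volume (A i q.1 ∩ A i q.2)).toReal / V := by
      have : ∀ q ∈ PP i, (753 / 250000 : ℝ) ≤ (volume (A i q.1 ∩ A i q.2)).toReal / V := by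
        intro q hq
        simp only [hPP_def, Finset.mem_filter, Finset.mem_product] at hq
        obtain ⟨⟨hq1, hq2⟩, hlt, hM⟩ := hq
        rw [hJ] at hq1 hq2
        have := hov' i q.1 q.2 (Ne.symm hq1.1) (Ne.symm hq2.1) (ne_of_lt hlt) hq1.2 hq2.2 hM
        rwa [ccore_bf_eq (Set.inter_subset_left.trans (hAball i q.1))] at this
      calc ((PP i).card : ℝ) * (753 / 250000) = ∑ q ∈ PP i, (753 / 250000 : ℝ) := by
            rw [Finset.sum_const, nsmul_eq_mul]
        _ ≤ _ := Finset.sum_le_sum this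
    rw [ccore_bf_eq ((hCK i).trans (hKball i))]
    have hCfrac : (volume (C i)).toReal / V = 357 / 2500 - (volume (⋃ j ∈ J i, A i j)).toReal / V := by
      rw [← hKfrac, hvK, add_div]; ring
    rw [hCfrac]
    have hb' : (volume (⋃ j ∈ J i, A i j)).toReal / V + ∑ q ∈ PP i, (volume (A i q.1 ∩ A i q.2)).toReal / V ≤
        ∑ j ∈ J i, (volume (A i j)).toReal / V := by
      rw [← Finset.sum_div, ← Finset.sum_div, ← add_div]
      exact div_le_div_of_nonneg_right hb hVpos.le
    linarith
  -- Step 4: the count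
  have hF : ∀ i, (357 / 2500 : ℝ) - 4 * (16423 / 1000000) + 2 * (753 / 250000) +
      (if ((J i).card = 4 ∧ (PP i).card = 2) then 0 else 753 / 250000) ≤ ballFraction (0 : (EuclideanSpace ℝ (Fin 3))) (C i) := by
    intro i
    refine le_trans ?_ (hlow i)
    have hk := hk4 i
    split_ifs with hgood
    · rw [hgood.1, hgood.2]; push_cast; linarith
    · by_cases hk4' : (J i).card = 4
      · have hm := hpig' i hk4'
        have hm3 : 3 ≤ (PP i).card := by
          rcases Nat.lt_or_ge (PP i).card 3 with h | h
          · exfalso; exact hgood ⟨hk4', by omega⟩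
          · exact h
        have hm3' : (3 : ℝ) ≤ (PP i).card := by exact_mod_cast hm3
        rw [hk4']; push_cast; nlinarith
      · have hk3 : (J i).card ≤ 3 := by omega
        have hk3' : ((J i).card : ℝ) ≤ 3 := by exact_mod_cast hk3
        have hm0 : (0 : ℝ) ≤ (PP i).card := Nat.cast_nonneg _
        nlinarith
  have hall : ∀ i, (J i).card = 4 ∧ (PP i).card = 2 := by
    by_contra hcon
    push Not at hcon
    obtain ⟨i₀, hi₀⟩ := hcon
    have hbad : ¬ ((J i₀).card = 4 ∧ (PP i₀).card = 2) := fun h => hi₀ h.1 h.2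
    have hsum' : ∑ i, ((357 / 2500 : ℝ) - 4 * (16423 / 1000000) + 2 * (753 / 250000) +
        (if ((J i).card = 4 ∧ (PP i).card = 2) then (0 : ℝ) else 753 / 250000)) ≤ 1 :=
      le_trans (Finset.sum_le_sum fun i _ => hF i) hsum
    rw [Finset.sum_add_distrib, Finset.sum_const, Finset.card_univ, Fintype.card_fin, nsmul_eq_mul] at hsum'
    have hge : (753 / 250000 : ℝ) ≤ ∑ i, (if ((J i).card = 4 ∧ (PP i).card = 2) then (0 : ℝ) else 753 / 250000) := by
      rw [← Finset.add_sum_erase Finset.univ _ (Finset.mem_univ i₀), if_neg hbad]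
      have : (0 : ℝ) ≤ ∑ i ∈ Finset.univ.erase i₀, (if ((J i).card = 4 ∧ (PP i).card = 2) then (0 : ℝ) else 753 / 250000) :=
        Finset.sum_nonneg fun i _ => by split_ifs <;> norm_num
      linarith
    push_cast at hsum'
    linarith
  -- conclusion
  intro i
  obtain ⟨hk, hm⟩ := hall i
  refine ⟨?_, ?_⟩
  · rw [hJset, Set.ncard_coe_finset]; exact hk
  · rw [hPPset, Set.ncard_coe_finset]; exact hm


end Summit.AtomisticToContinuum.Crystallization.Theorems.ZeroDefectDensityBirth

end
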